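import Literature.Geometry.Riemannian.PerelmanNoncollapsingInteriorHeat
import Literature.Geometry.Lorentzian.RiemannianMeasureComparison
import Mathlib.MeasureTheory.Function.LocallyIntegrable
import HarnessLib

/-!
# Very weak solutions of the linear heat equation on a closed manifold: the junction between
# weak existence and interior regularity

`LinearHeatInitialLayer.lean` reduces the named fact `perelman_noLocalCollapsing` (Perelman 2002,
§4, Thm. 4.1) to `hLHF`: on a closed manifold `M` modelled on `ℝ^m`, for smooth data `(h, Q)` on
`M × [a, c]` (`a < 0 < c`) and smooth forcing `F` vanishing for `s ≤ 0`, the forced linear heat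
equation `∂ₛv = Δ_{h(s)}v − Qv + F` has a solution smooth on the OPEN slab `M × (a, c)` vanishing
for `s ≤ 0`. Its proof splits into EXISTENCE of a very weak (`L¹_loc`) solution (Lions' projection
theorem, `Literature.Analysis.OperatorTheory.exists_eq_of_coercive`, in `L²` of space-time) and
INTERIOR REGULARITY of very weak solutions (Hörmander 1967, Thm. 1.1, proved in the tree; in
coordinates: `Literature.Analysis.Distribution.exists_contDiffOn_ae_eq_of_heat_veryWeak`,
`HeatHypoelliptic.lean`). This file fixes the notion of very weak solution at which the two halves
meet, chart-free, with respect to the FIXED reference measure `dV_{h(a)} ⊗ ds` on `M × ℝ`: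

* `volumeDensity h s₀ s x = √det (h(s₀)⁻¹ h(s))ₓ` — the density `dV_{h(s)} = J(s, ·) dV_{h(s₀)}`
  (`riemVolume_eq_withDensity_volumeDensity`, from
  `Lorentzian.riemannianMeasure_eq_withDensity_sqrt_det_endo`; Chavel 2006, §III.3), positive
  (`volumeDensity_pos`) and continuous in `x` (`continuous_volumeDensity`);
* `heatTestOp h Q a ψ (s, x) = −∂ₛ(J ψ)(s, x) − J Δ_{h(s)}ψ(s)(x) + J Q ψ` (`J = volumeDensity h a`)
  — the formal transpose, with respect to `dV_{h(a)} ds`, of `v ↦ J (∂ₛv − Δ_{h(s)}v + Qv)`;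
* `IsVeryWeakHeatSolution h Q F a c u` — `u` is locally integrable on `M × (a, c)` for
  `dV_{h(a)} ⊗ ds` and `∫ u · heatTestOp ψ = ∫ J F ψ` for every smooth `ψ` on `M × ℝ` supported in
  `M × (a, c)` (on a compact `M` these are exactly the smooth compactly supported functions of the
  open slab).

In the chart `φ` at `x₀` (product chart `φ × id` of `M × ℝ`), `dV_{h(a)} = √det ĥ(a) dy` and
`J √det ĥ(a) = √det ĥ(s)`, so the identity is the coordinate very weak equation
`∫ û · heatTranspose A 𝒥 q ψ̂ = ∫ 𝒥 F̂ ψ̂` of `HeatHypoelliptic.lean` with `𝒥 = √det ĥ(s)`,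
`A = 𝒥 ĥ(s)⁻¹`, `q = 𝒥 Q̂` (divergence form of the Laplace–Beltrami operator,
`Literature.Analysis.Calculus.coordLaplacian_mul_sqrt_det_eq_sum_fderiv`). The two remaining
theorems towards `hLHF` are thus: (W) for `F` smooth on `M × [a, c]` vanishing for `s ≤ 0` there is
a very weak solution `u` vanishing for `s ≤ 0` (zero initial datum at an interior time `a₁ < 0`,
Lions' theorem, zero extension); (R) a very weak solution agrees a.e. with a function smooth on
`M × (a, c)` solving the equation classically (chart transfer + `exists_contDiffOn_ae_eq_of_heat_veryWeak`
+ patching), which then vanishes for `s ≤ 0` by `linearHeat_unique`.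

Everything here is proved; three definitions with unfolding lemmas; no named facts.

## References

* J.-L. Lions, E. Magenes, *Non-homogeneous boundary value problems and applications* I (1972),
  Chap. 3, §4 (weak parabolic problems). [folklore]
* L. Hörmander, Acta Math. 119 (1967), Thm. 1.1. [Hormander1967]
* I. Chavel, *Riemannian Geometry: A Modern Introduction*, 2nd ed. (2006), §III.3, §III.7. [Chavel2006]
-/

noncomputable section

open Set Function Filter MeasureTheory
open scoped Topology ContDiff Manifold ENNReal

namespace Literature.Geometry.Riemannian

open Lorentzian Lorentzian.PseudoRiemannianMetric

variable {m : ℕ} {H : Type*} [TopologicalSpace H]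
  {I : ModelWithCorners ℝ (EuclideanSpace ℝ (Fin m)) H}
  {M : Type*} [TopologicalSpace M] [ChartedSpace H M] [IsManifold I ∞ M]

/-! ### The density of `dV_{h(s)}` with respect to `dV_{h(s₀)}` -/

/-- **The volume density of a family of metrics**: `volumeDensity h s₀ s x = √det Tₓ`,
`Tₓ = ♯_{h(s₀)} ∘ ♭_{h(s)} : TₓM → TₓM` (`h(s)(v, w) = h(s₀)(Tₓ v, w)`), i.e. `√(det h(s)ᵢⱼ / det h(s₀)ᵢⱼ)`
in any frame: the density `dV_{h(s)} = volumeDensity h s₀ s · dV_{h(s₀)}` (Chavel 2006, §III.3,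
(III.3.5)–(III.3.6); Topping 2006, Prop. 2.3.12). [cite: Chavel2006, §III.3 (III.3.5)–(III.3.6)] -/
def volumeDensity (h : ℝ → PseudoRiemannianMetric I ∞ (EuclideanSpace ℝ (Fin m)) (TangentSpace I : M → Type _))
    (s₀ s : ℝ) (x : M) : ℝ :=
  Real.sqrt (LinearMap.det (((h s₀).sharp x).toLinearMap ∘ₗ (h s).toBilinForm x))

/-- Unfolding `volumeDensity`. [folklore] -/
theorem volumeDensity_apply
    (h : ℝ → PseudoRiemannianMetric I ∞ (EuclideanSpace ℝ (Fin m)) (TangentSpace I : M → Type _))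
    (s₀ s : ℝ) (x : M) :
    volumeDensity h s₀ s x =
      Real.sqrt (LinearMap.det (((h s₀).sharp x).toLinearMap ∘ₗ (h s).toBilinForm x)) := rfl

variable {h : ℝ → PseudoRiemannianMetric I ∞ (EuclideanSpace ℝ (Fin m)) (TangentSpace I : M → Type _)}

/-- The tree's pseudo-Riemannian metric of the Mathlib Riemannian metric of a Riemannian `g` is
`g` (same scalar products); local copy of the bridge lemma. [folklore] -/
theorem ofRiemannian_toContMDiffRiemannianMetric_eq
    (g : PseudoRiemannianMetric I ∞ (EuclideanSpace ℝ (Fin m)) (TangentSpace I : M → Type _))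
    (hg : g.IsRiemannian) : ofRiemannian (g.toContMDiffRiemannianMetric hg) = g := by
  ext
  rfl

/-- **`dV_{h(s)} = volumeDensity h s₀ s · dV_{h(s₀)}`** for Riemannian `h(s₀)`, `h(s)` on a
second-countable manifold modelled on `ℝ^m` (`riemannianMeasure_eq_withDensity_sqrt_det_endo`).
[cite: Chavel2006, §III.3 (III.3.5)–(III.3.6)] -/
theorem riemVolume_eq_withDensity_volumeDensity [T3Space M] [SecondCountableTopology M]
    [MeasurableSpace M] [BorelSpace M] {s₀ s : ℝ} (h₀ : (h s₀).IsRiemannian) (hs : (h s).IsRiemannian) :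
    (h s).riemVolume = ((h s₀).riemVolume).withDensity fun x ↦ ENNReal.ofReal (volumeDensity h s₀ s x) := by
  rw [riemVolume_eq hs, riemVolume_eq h₀,
    riemannianMeasure_eq_withDensity_sqrt_det_endo ((h s).toContMDiffRiemannianMetric hs)
      ((h s₀).toContMDiffRiemannianMetric h₀)]
  simp only [ofRiemannian_toContMDiffRiemannianMetric_eq, volumeDensity]

/-- **The volume density is positive** (both Gram determinants are positive). [folklore] -/
theorem volumeDensity_pos {s₀ s : ℝ} (h₀ : (h s₀).IsRiemannian) (hs : (h s).IsRiemannian) (x : M) :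
    0 < volumeDensity h s₀ s x := by
  have hdet := det_endo_pos ((h s).toContMDiffRiemannianMetric hs) ((h s₀).toContMDiffRiemannianMetric h₀) x
  simp only [ofRiemannian_toContMDiffRiemannianMetric_eq] at hdet
  exact Real.sqrt_pos.2 hdet

/-- **The volume density is continuous in space** at every time. [folklore] -/
theorem continuous_volumeDensity {s₀ s : ℝ} (h₀ : (h s₀).IsRiemannian) (hs : (h s).IsRiemannian) :
    Continuous fun x ↦ volumeDensity h s₀ s x := by
  have hc := continuous_sqrt_det_endo ((h s).toContMDiffRiemannianMetric hs)
    ((h s₀).toContMDiffRiemannianMetric h₀)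
  simp only [ofRiemannian_toContMDiffRiemannianMetric_eq] at hc
  exact hc

/-- At the reference time the density is `1`. [folklore] -/
theorem volumeDensity_self (s₀ : ℝ) (x : M) : volumeDensity h s₀ s₀ x = 1 := by
  rw [volumeDensity_apply]
  have hid : ((h s₀).sharp x).toLinearMap ∘ₗ (h s₀).toBilinForm x = LinearMap.id := by
    apply LinearMap.ext
    intro v
    simp only [LinearMap.coe_comp, comp_apply, LinearMap.id_coe, id_eq, LinearEquiv.coe_coe]
    exact (h s₀).sharp_flat x v
  rw [hid, LinearMap.det_id, Real.sqrt_one]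

/-! ### The transpose operator on test functions and very weak solutions -/

/-- **The test-side operator**: `heatTestOp h Q a ψ s x = −∂ₛ(J ψ)(s, x) − J(s, x) Δ_{h(s)} ψ(s)(x)
+ J(s, x) Q(s, x) ψ(s, x)`, `J = volumeDensity h a` — the formal transpose with respect to the
reference measure `dV_{h(a)} ds` of `v ↦ J (∂ₛv − Δ_{h(s)}v + Qv)` (integration by parts in `s`
and Green's identity `∫ Δv ψ dV_{h(s)} = ∫ v Δψ dV_{h(s)}` on the closed manifold). [folklore] -/
def heatTestOp (h : ℝ → PseudoRiemannianMetric I ∞ (EuclideanSpace ℝ (Fin m)) (TangentSpace I : M → Type _))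
    (Q : ℝ → M → ℝ) (a : ℝ) (ψ : ℝ → M → ℝ) (s : ℝ) (x : M) : ℝ :=
  -(deriv (fun σ ↦ volumeDensity h a σ x * ψ σ x) s) -
    volumeDensity h a s x * (h s).laplaceBeltrami (ψ s) x +
    volumeDensity h a s x * Q s x * ψ s x

/-- Unfolding `heatTestOp`. [folklore] -/
theorem heatTestOp_apply
    (h : ℝ → PseudoRiemannianMetric I ∞ (EuclideanSpace ℝ (Fin m)) (TangentSpace I : M → Type _))
    (Q : ℝ → M → ℝ) (a : ℝ) (ψ : ℝ → M → ℝ) (s : ℝ) (x : M) :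
    heatTestOp h Q a ψ s x = -(deriv (fun σ ↦ volumeDensity h a σ x * ψ σ x) s) -
      volumeDensity h a s x * (h s).laplaceBeltrami (ψ s) x +
      volumeDensity h a s x * Q s x * ψ s x := rfl

/-- **Very weak solutions of `∂ₛv = Δ_{h(s)}v − Qv + F` on the open slab `M × (a, c)`.**
`u : ℝ → M → ℝ` is a very weak solution for the data `(h, Q, F)` on `(a, c)` if
`(x, s) ↦ u s x` is locally integrable on `M × (a, c)` for the reference measure
`dV_{h(a)} ⊗ ds` and, for every `ψ : ℝ → M → ℝ` with `(x, s) ↦ ψ s x` smooth on `M × ℝ` and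
supported in `M × (a, c)`,
`∫ u · heatTestOp h Q a ψ d(dV_{h(a)} ⊗ ds) = ∫ J F ψ d(dV_{h(a)} ⊗ ds)`, `J = volumeDensity h a`
(for smooth `v` this is the equation multiplied by `J ψ` and integrated by parts). The junction
between weak existence (Lions) and interior regularity (Hörmander) in the proof of the linear
heat existence theorem on closed manifolds. [folklore] -/
def IsVeryWeakHeatSolution [MeasurableSpace M] [T3Space M] [BorelSpace M]
    (h : ℝ → PseudoRiemannianMetric I ∞ (EuclideanSpace ℝ (Fin m)) (TangentSpace I : M → Type _))
    (Q F : ℝ → M → ℝ) (a c : ℝ) (u : ℝ → M → ℝ) : Prop :=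
  LocallyIntegrableOn (fun p : M × ℝ ↦ u p.2 p.1) (univ ×ˢ Ioo a c)
      (((h a).riemVolume).prod volume) ∧
    ∀ ψ : ℝ → M → ℝ, ContMDiff (I.prod 𝓘(ℝ, ℝ)) 𝓘(ℝ, ℝ) ∞ (fun p : M × ℝ ↦ ψ p.2 p.1) →
      tsupport (fun p : M × ℝ ↦ ψ p.2 p.1) ⊆ univ ×ˢ Ioo a c →
      ∫ p, u p.2 p.1 * heatTestOp h Q a ψ p.2 p.1 ∂(((h a).riemVolume).prod volume) =
        ∫ p, volumeDensity h a p.2 p.1 * F p.2 p.1 * ψ p.2 p.1 ∂(((h a).riemVolume).prod volume)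

/-- Unfolding `IsVeryWeakHeatSolution`. [folklore] -/
theorem isVeryWeakHeatSolution_iff [MeasurableSpace M] [T3Space M] [BorelSpace M]
    (h : ℝ → PseudoRiemannianMetric I ∞ (EuclideanSpace ℝ (Fin m)) (TangentSpace I : M → Type _))
    (Q F : ℝ → M → ℝ) (a c : ℝ) (u : ℝ → M → ℝ) :
    IsVeryWeakHeatSolution h Q F a c u ↔
      LocallyIntegrableOn (fun p : M × ℝ ↦ u p.2 p.1) (univ ×ˢ Ioo a c)
          (((h a).riemVolume).prod volume) ∧
        ∀ ψ : ℝ → M → ℝ, ContMDiff (I.prod 𝓘(ℝ, ℝ)) 𝓘(ℝ, ℝ) ∞ (fun p : M × ℝ ↦ ψ p.2 p.1) →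
          tsupport (fun p : M × ℝ ↦ ψ p.2 p.1) ⊆ univ ×ˢ Ioo a c →
          ∫ p, u p.2 p.1 * heatTestOp h Q a ψ p.2 p.1 ∂(((h a).riemVolume).prod volume) =
            ∫ p, volumeDensity h a p.2 p.1 * F p.2 p.1 * ψ p.2 p.1
              ∂(((h a).riemVolume).prod volume) :=
  Iff.rfl

end Literature.Geometry.Riemannian

end
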